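import Summits.BirchSwinnertonDyer.BirchSwinnertonDyer.Theorems.PrintX9AnticyclotomicFormalGroupH1
import Summits.BirchSwinnertonDyer.Rank1Residual.Additive.GoodModelKummerOfCoatesGreenberg
import Literature.NumberTheory.EllipticCurves.Greenberg1999.KummerImageGoodOrdinaryNumberField
import HarnessLib

/-!
# Greenberg's Prop. 2.4 (`Im λ ⊆ Im κ`) over the ANTICYCLOTOMIC tower above a split prime — the
# Tate direction of the leaf (G-2.4), as a kernel theorem (cell `pub/bsd-print-x9`, CG-FRAME (D), item 23237)

The print leaf `Greenberg1999.imKummer_eq_strictCondition_goodOrdinary_numberField` (Greenberg, LNM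
1716, §2 Prop. 2.4: `Im(κ_L) = Im(λ_L)` at a good ordinary `v ∣ p` over the layers of a `ℤ_p`-tower
ramified at `v`; route leaf `CoatesGreenbergKummerImage`, stmt-BirchSwinnertonDyer-23427) is consumed
by the closed μ-crux stmt-BirchSwinnertonDyer-23428 at exactly two places, both at the layer
`H = ker κ` with the canonical datum `C_v = E[p^∞] ∩ E₁(K̄_v)`:

* (B4-p) `WeierstrassCurve.eisensteinTowerReadout_of_mem_localKerOver`
  (`ZpExtensionEisensteinReadoutOrdinaryStrictProofs`) through
  `…numberField.kerSubgroup_strictKer_kernelOfReduction_le_localKerOver` — the direction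
  `Im λ ⊆ Im κ` (strict classes over `K_∞` are Kummer; Tate / Coates–Greenberg);
* (B5-P) `WeierstrassCurve.exists_grMk_eq_coboundary_of_mem_localKerOver`
  (`ZpExtensionEisensteinReadoutOrdinaryPrincipalProofs`) through `….kerSubgroup_kernelOfReduction … .le`
  — the direction `Im κ ⊆ Im λ` (Prop. 2.2 (i)).

This file proves the FIRST direction, unconditionally, on the frames of the routes PrintX9 / PrintX10b
(`K` imaginary quadratic, `p` odd and split in `K`, `κ` anticyclotomic, good reduction at `v`):

* `strictKer_kernelOfReduction_le_localKerOver_of_isAnticyclotomic :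
    (W.kernelOfReductionLocalDatum p v).strictKer κ.kerSubgroup ≤ W.localKerOver p κ.kerSubgroup K_v`

— Greenberg's mechanism (LNM 1716 p. 83, "just as in the case of Kummer theory for the
multiplicative group"; the tree's S2 derivation `GoodModelLine.imKummer_ge_strictCondition_
goodOrdinaryModel_of_coatesGreenberg` for `ℚ` and the cyclotomic tower, here ported to a number field
and the canonical datum): a strict class restricted to `(ker κ)_v` is, modulo the coboundary of a lift
of the principalising class, a cocycle with values in `E₁(K̄_v)`, hence — by the anticyclotomic
Coates–Greenberg vanishing `AnticyclotomicFormalGroupH1.exists_mem_localKernelOfReduction_eq_smul_sub_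
of_isAnticyclotomic` (C2) — a coboundary: the Kummer condition.  No ordinarity hypothesis is used
(as in S2: `Im λ ⊆ Im κ` holds over every deeply ramified field, [CoGr] Prop. 4.3).  THEOREMS ONLY; no
Theses import.  BSD is not proved by any of this.

References: [GreenbergLNM1716] §2 Prop. 2.4 (pp. 79–80), p. 83; [CoatesGreenberg1996] Prop. 4.3,
Cor. 3.2; [Greenberg1989] §1 p. 98 (strict condition); [LeeCY2013] Thm. 2.4.2.
-/

-- the summit namespace `Summit.BirchSwinnertonDyer.BirchSwinnertonDyer` repeats the problem name by design (D-0017)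
set_option linter.dupNamespace false

noncomputable section

open scoped Classical NNReal

open WeierstrassCurve NumberField IsDedekindDomain Field IsDedekindDomain.HeightOneSpectrum
  Literature.NumberTheory.GaloisRepresentations Literature.NumberTheory.EllipticCurves
  Literature.NumberTheory.EllipticCurves.GreenbergSelmer
  Summit.BirchSwinnertonDyer.Rank1Residual.X2.GreenbergVatsalSelmerLink
  Summit.BirchSwinnertonDyer.Rank1Residual.Additive.GoodModelLine

namespace Summit.BirchSwinnertonDyer.BirchSwinnertonDyer.Theorems.KummerImageOfAnticyclotomic

variable {K : Type} [Field K] [NumberField K]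

/-- **Greenberg Prop. 2.4, direction `Im λ ⊆ Im κ`, over `K_∞⁻` above a split prime — a kernel
theorem.**  For `K` imaginary quadratic, `p` odd and split in `K` (`v ≠ v̄` above `p`), `κ`
anticyclotomic and `E = W/K` elliptic with good reduction at `v`: every class of `H¹(ker κ, E[p^∞])`
that is STRICT at the place above `v` for Greenberg's `C_v = E[p^∞] ∩ E₁(K̄_v)`
(`(W.kernelOfReductionLocalDatum p v).strictKer (ker κ)`) is KUMMER there
(`W.localKerOver p (ker κ) K_v`).  This is the instance consumed from the leaf (G-2.4) by (B4-p)
`eisensteinTowerReadout_of_mem_localKerOver`, now proved: the strict class restricted to `(ker κ)_v`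
minus the coboundary of a lift of its principalising class has values in `E₁(K̄_v)`, and
`H¹((ker κ)_v, E₁(K̄_v)) = 0` (C2). [cite: GreenbergLNM1716, §2 Prop. 2.4 (pp. 79–80) and p. 83]
[cite: CoatesGreenberg1996, Prop. 4.3 and Cor. 3.2] [cite: Greenberg1989, §1 p. 98] -/
theorem strictKer_kernelOfReduction_le_localKerOver_of_isAnticyclotomic
    (W : WeierstrassCurve K) [W.IsElliptic] (p : ℕ) [Fact p.Prime] (v : HeightOneSpectrum (𝓞 K))
    (hK : IsImaginaryQuadratic K) (hp2 : p ≠ 2) (κ : ZpExtension K p) (hκ : κ.IsAnticyclotomic)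
    {vbar : HeightOneSpectrum (𝓞 K)} (hpv : ((p : ℕ) : 𝓞 K) ∈ v.asIdeal)
    (hpvbar : ((p : ℕ) : 𝓞 K) ∈ vbar.asIdeal) (hne : vbar ≠ v) (hgood : W.HasGoodReductionAt v) :
    (W.kernelOfReductionLocalDatum p v).strictKer κ.kerSubgroup ≤
      W.localKerOver p κ.kerSubgroup (v.adicCompletion K) := by
  intro c hc
  obtain ⟨f, rfl⟩ := oneCocycleClass_surjective (discreteTopRep κ.kerSubgroup (W.geomPrimaryTorsion p)) c
  obtain ⟨q, hq⟩ :=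
    (oneCocycleClass_mem_strictKer_iff κ.kerSubgroup _ (W.kernelOfReductionLocalDatum p v) f).1 hc
  obtain ⟨m, rfl⟩ := (W.kernelOfReductionLocalDatum p v).grMk_surjective q
  -- the pulled-back cocycle `F τ = ι (f (res τ))` on `G = (ker κ)_v`
  set F : contOneCocycles (discreteTopRep (localSubgroup κ.kerSubgroup (v.adicCompletion K))
      (localPoints W (v.adicCompletion K))) :=
    contOneCocycles.pullback (resGalSubgroup κ.kerSubgroup (v.adicCompletion K))
      (resHomOfEquivariant (resGalSubgroup κ.kerSubgroup (v.adicCompletion K))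
        ((pointsMap W (v.adicCompletion K)).comp (W.geomPrimaryTorsion p).subtype) fun τ P ↦ by
          simp only [AddMonoidHom.coe_comp, AddSubgroup.coe_subtype, Function.comp_apply,
            Subgroup.smul_def, resGalSubgroup_apply_coe,
            Literature.NumberTheory.EllipticCurves.primaryComponent.coe_smul]
          exact pointsMap_smul W (v.adicCompletion K) τ P) f with hF
  have hFapply : ∀ τ : localSubgroup κ.kerSubgroup (v.adicCompletion K),
      F.1 τ = pointsMap W (v.adicCompletion K)
        ((f.1 (resGalSubgroup κ.kerSubgroup (v.adicCompletion K) τ) : W.geomPrimaryTorsion p) :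
          W.geomPoints) := fun τ ↦ rfl
  -- the coboundary of `ι m`
  have hcont : Continuous fun τ : localSubgroup κ.kerSubgroup (v.adicCompletion K) ↦
      τ • pointsMap W (v.adicCompletion K) (m : W.geomPoints) := by
    have hc : Continuous ((fun σ : absoluteGaloisGroup (v.adicCompletion K) ↦
        σ • pointsMap W (v.adicCompletion K) (m : W.geomPoints)) ∘
        (Subtype.val : localSubgroup κ.kerSubgroup (v.adicCompletion K) →
          absoluteGaloisGroup (v.adicCompletion K))) :=
      (continuous_smul_localPoints W (v.adicCompletion K) _).comp continuous_subtype_val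
    exact hc
  set ψ : contOneCocycles (discreteTopRep (localSubgroup κ.kerSubgroup (v.adicCompletion K))
      (localPoints W (v.adicCompletion K))) :=
    F - coboundaryCocycle (pointsMap W (v.adicCompletion K) (m : W.geomPoints)) hcont with hψ
  -- each `τ ∈ (ker κ)_v` gives an element of `ker κ ⊓ D_v`
  have hyτ : ∀ τ : localSubgroup κ.kerSubgroup (v.adicCompletion K), ∃ y : decompIn κ.kerSubgroup v,
      decompInToH κ.kerSubgroup v y = resGalSubgroup κ.kerSubgroup (v.adicCompletion K) τ ∧
        ((y : decomp (K := K) v) : absoluteGaloisGroup K) =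
          absGaloisRestrict K (v.adicCompletion K) τ := by
    intro τ
    have hτH : absGaloisRestrict K (v.adicCompletion K) τ ∈ κ.kerSubgroup :=
      (mem_localSubgroup_iff κ.kerSubgroup (v.adicCompletion K) τ.1).1 τ.2
    refine ⟨⟨⟨absGaloisRestrict K (v.adicCompletion K) τ, (mem_decomp_iff v _).2 ⟨τ, rfl⟩⟩,
      (mem_decompIn_iff κ.kerSubgroup v _).2 hτH⟩, Subtype.ext rfl, rfl⟩
  -- `ψ τ = ι (f (res τ) - (res τ • m - m))` and the bracket lies in `C_v`
  have hψval : ∀ τ : localSubgroup κ.kerSubgroup (v.adicCompletion K), ∃ n : W.geomPrimaryTorsion p,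
      n ∈ (W.kernelOfReductionLocalDatum p v).plus ∧
        ψ.1 τ = pointsMap W (v.adicCompletion K) (n : W.geomPoints) := by
    intro τ
    obtain ⟨y, hy, hy'⟩ := hyτ τ
    refine ⟨f.1 (resGalSubgroup κ.kerSubgroup (v.adicCompletion K) τ) -
      (absGaloisRestrict K (v.adicCompletion K) τ • m - m), ?_, ?_⟩
    · have hym : y • (W.kernelOfReductionLocalDatum p v).grMk m =
          (W.kernelOfReductionLocalDatum p v).grMk (absGaloisRestrict K (v.adicCompletion K) τ • m) := by
        rw [← hy']; rfl
      rw [← (W.kernelOfReductionLocalDatum p v).ker_grMk, AddMonoidHom.mem_ker, map_sub, map_sub,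
        ← hy, hq y, hym]
      exact sub_self _
    · rw [hψ, cocycle_sub_apply, coboundaryCocycle_apply, hFapply]
      simp only [AddSubgroupClass.coe_sub, map_sub,
        Literature.NumberTheory.EllipticCurves.primaryComponent.coe_smul]
      have hsm : pointsMap W (v.adicCompletion K)
          (absGaloisRestrict K (v.adicCompletion K) (τ : absoluteGaloisGroup (v.adicCompletion K)) •
            (m : W.geomPoints)) = τ • pointsMap W (v.adicCompletion K) (m : W.geomPoints) :=
        pointsMap_smul W (v.adicCompletion K) (τ : absoluteGaloisGroup (v.adicCompletion K))
          (m : W.geomPoints)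
      rw [hsm]
  -- hence `ψ` has values in `E₁(K̄_v)`
  have hkernel : ∀ τ : localSubgroup κ.kerSubgroup (v.adicCompletion K),
      ψ.1 τ ∈ W.localKernelOfReduction v := by
    intro τ
    obtain ⟨n, hn, hψn⟩ := hψval τ
    rw [hψn]
    exact (W.mem_kernelOfReductionLocalDatum_plus_iff p v n).1 hn
  -- the anticyclotomic Coates–Greenberg vanishing: `ψ` is the coboundary of some `a ∈ E₁(K̄_v)`
  obtain ⟨a, -, hφa⟩ :=
    AnticyclotomicFormalGroupH1.exists_mem_localKernelOfReduction_eq_smul_sub_of_isAnticyclotomic W v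
      hK hp2 κ hκ hpv hpvbar hne hgood ψ hkernel
  -- so `F = ∂(a + ι m)`: the Kummer condition
  refine (oneCocycleClass_mem_localKerOver_iff W p κ.kerSubgroup (v.adicCompletion K) f).2
    ⟨a + pointsMap W (v.adicCompletion K) (m : W.geomPoints), fun τ ↦ ?_⟩
  have h := hφa τ
  rw [hψ, cocycle_sub_apply, coboundaryCocycle_apply, hFapply, sub_eq_iff_eq_add] at h
  rw [h, Subgroup.smul_def, Subgroup.smul_def, smul_add]
  abel

end Summit.BirchSwinnertonDyer.BirchSwinnertonDyer.Theorems.KummerImageOfAnticyclotomic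

end
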